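import Summits.Ventures.HSemireg.WedgeHankelRecurrenceGaussWendroff

/-!
# Venture HSemireg — **THE STIELTJES TRANSFORM OF THE FAVARD ∕ GAUSS MEASURE IS THE PADÉ APPROXIMANT `r_{m+1}/q_{m+1}`**: with the second-kind polynomials `r` (N281) and the Favard
# weights `μ_k` at the zeros `z_k` of `q_{m+1}`:  `r_{m+1} = Σ_k μ_k ∏_{j ≠ k} (X − z_j)` (partial fractions), hence `Σ_k μ_k/(y − z_k) = r_{m+1}(y)/q_{m+1}(y)` off the zeros — the `(m+1)`-th
# convergent of the J-fraction `1/(y − a_0 − b_1/(y − a_1 − ⋯))` is the Stieltjes transform of the `(m+1)`-point Gauss rule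

HONEST FRAMING. Part of the Lean index of the computation cell `pub-hsemireg` (seat p10 gen 42, Sunday typer «UNIFORM-IN-n»).  Real polynomials and finite sums only (Mathlib
`Lagrange.eval_nodal_derivative_eval_node_eq`, `Polynomial.eq_of_degrees_lt_of_eval_index_eq`); no variety, no cohomology theory, no sheaf, no Ext group and no semiregularity map is constructed
here; nothing here says that HC / HC_CM / HC_AV holds; no Literature fact (unproved `Prop`) is declared or used.  Custodian versions as in `WedgeHankelSiegelIdeal` (1/3).
SOURCES (cited).  T. J. Stieltjes, *Recherches sur les fractions continues*, Ann. Fac. Sci. Toulouse 8 (1894), §§1–11; T. S. Chihara, *An Introduction to Orthogonal Polynomials* (1978),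
Ch. III §4 (4.9)–(4.12) (the `n`-th convergent `P^{(1)}_{n−1}/P_n` of the J-fraction and its partial-fraction expansion over the Gauss weights); N. I. Akhiezer, *The Classical Moment Problem*
(1965), Ch. I §§2–4 (quasi-orthogonal polynomials, (4.13)); G. Szegő, *Orthogonal Polynomials*, §3.5; this lineage's `StieltjesFraction` ∕ `PartialFractions` modules (Hankel side).
PROOF TYPED HERE.  `r_{m+1}` and `Σ_k μ_k ∏_{j≠k}(X − z_j)` have degree `≤ m` and agree at the `m + 1` zeros: at `z_i` the right side is `μ_i ∏_{j≠i}(z_i − z_j) = μ_i q_{m+1}′(z_i) = r_{m+1}(z_i)`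
by the residue formula of N281.  Dividing by `q_{m+1}(y) = (y − z_k) ∏_{j≠k}(y − z_j)` gives the Stieltjes transform.
DEDUP DISCLOSURE (`rg -n 'Pade|padé|stieltjes transform' Summits/Ventures/HSemireg/WedgeHankelRecurrenceGauss*`, 2026-09-02): nothing on the recurrence side (the lineage's
`StieltjesFraction` is about Hurwitz polynomials' continued fractions).  The 4 names below: 0 hits tree-wide.

WHAT IS IN THE TREE.  N279 `recurrence_zeros`, `eq_prod_X_sub_C_of_monic_of_roots`, `recurrence_monic_natDegree`; N281 `favard_weight_eq_secondKind_div_derivative`,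
`recurrence_secondKind_eval_at_zero`; Mathlib `Lagrange.nodal`, `Lagrange.eval_nodal_derivative_eval_node_eq`, `Polynomial.eq_of_degrees_lt_of_eval_index_eq`.
THIS FILE (namespace `Summit.Ventures.HSemireg.Wedge.HankelOuter` continued; CHAINED on N282 (import), N279, N281; 0 definitions):
* §1049 `secondKind_monic_natDegree` (`r_{n+1}` monic of degree `n`), `eval_derivative_prod_X_sub_C_at_node` (`q′(z_i) = ∏_{j≠i}(z_i − z_j)`), **`secondKind_eq_sum_weight_mul_prod`** (PARTIAL FRACTIONS
  `r_{m+1} = Σ_k μ_k ∏_{j≠k}(X − z_j)`), **`sum_weight_div_sub_eq_secondKind_div`** (`Σ_k μ_k/(y − z_k) = r_{m+1}(y)/q_{m+1}(y)` for `q_{m+1}(y) ≠ 0`).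
CAVEATS.  Nothing Ext-side.  New names only.
-/

open Module Polynomial
open scoped Matrix Polynomial

namespace Summit.Ventures.HSemireg.Wedge.HankelOuter

/-! ## §1049. The Stieltjes transform of the Gauss rule -/

/-- `r_{n+1}` is monic of degree `n` (`r_0 = 0`, `r_1 = 1`, same recurrence). [bookkeeping; this file, §1049] -/
theorem secondKind_monic_natDegree {r : ℕ → ℝ[X]} {a b : ℕ → ℝ} (hr0 : r 0 = 0) (hr1 : r 1 = 1)
    (hrrec : ∀ n, r (n + 2) = (Polynomial.X - C (a (n + 1))) * r (n + 1) - C (b (n + 1)) * r n) (n : ℕ) : (r (n + 1)).Monic ∧ (r (n + 1)).natDegree = n := by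
  have key : ∀ n, ((r (n + 1)).Monic ∧ (r (n + 1)).natDegree = n) ∧ ((r (n + 2)).Monic ∧ (r (n + 2)).natDegree = n + 1) := by
    intro n
    induction n with
    | zero =>
      have h2 : r 2 = Polynomial.X - C (a 1) := by rw [hrrec 0, hr1, hr0, mul_one, mul_zero, sub_zero]
      exact ⟨⟨by rw [hr1]; exact monic_one, by rw [hr1, natDegree_one]⟩, by rw [h2]; exact monic_X_sub_C _, by rw [h2, natDegree_X_sub_C]⟩
    | succ n ih =>
      obtain ⟨⟨h0m, h0d⟩, h1m, h1d⟩ := ih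
      refine ⟨⟨h1m, h1d⟩, ?_⟩
      have hPm : ((Polynomial.X - C (a (n + 2))) * r (n + 2)).Monic := (monic_X_sub_C _).mul h1m
      have hPd : ((Polynomial.X - C (a (n + 2))) * r (n + 2)).natDegree = n + 2 := by rw [(monic_X_sub_C _).natDegree_mul h1m, natDegree_X_sub_C, h1d]; ring
      have hlt : (C (b (n + 2)) * r (n + 1)).degree < ((Polynomial.X - C (a (n + 2))) * r (n + 2)).degree := by
        rw [degree_eq_natDegree hPm.ne_zero, hPd]
        refine lt_of_le_of_lt (degree_mul_le _ _) ?_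
        refine lt_of_le_of_lt (add_le_add degree_C_le degree_le_natDegree) ?_
        rw [h0d, zero_add]; exact_mod_cast (by omega : n < n + 2)
      have hq3 : r (n + 3) = (Polynomial.X - C (a (n + 2))) * r (n + 2) - C (b (n + 2)) * r (n + 1) := hrrec (n + 1)
      rw [hq3]
      refine ⟨hPm.sub_of_left hlt, ?_⟩
      have hd := degree_sub_eq_left_of_degree_lt hlt
      rw [degree_eq_natDegree hPm.ne_zero, hPd] at hd
      exact natDegree_eq_of_degree_eq_some hd
  exact (key n).1

/-- `(∏_j (X − z_j))′(z_i) = ∏_{j ≠ i} (z_i − z_j)`. [Mathlib `Lagrange.eval_nodal_derivative_eval_node_eq`; this file, §1049] -/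
theorem eval_derivative_prod_X_sub_C_at_node {n : ℕ} (z : Fin n → ℝ) (i : Fin n) :
    (derivative (∏ j, (Polynomial.X - C (z j)))).eval (z i) = ∏ j ∈ Finset.univ.erase i, (z i - z j) := by
  have h := Lagrange.eval_nodal_derivative_eval_node_eq (s := Finset.univ) (v := z) (Finset.mem_univ i)
  rw [Lagrange.nodal_eq, Lagrange.nodal_eq, eval_prod] at h
  rw [h]
  exact Finset.prod_congr rfl fun j _ => by rw [eval_sub, eval_X, eval_C]

/-- **PARTIAL FRACTIONS OF THE PADÉ NUMERATOR**: with the zeros `z_0 < ⋯ < z_m` of `q_{m+1}` and the Favard weights `μ_k = (b_1⋯b_m)/(q_{m+1}′(z_k) q_m(z_k))`,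
`r_{m+1} = Σ_k μ_k ∏_{j ≠ k} (X − z_j)`. [Chihara III §4 (4.11); Akhiezer I §4; this file, §1049] -/
theorem secondKind_eq_sum_weight_mul_prod {q r : ℕ → ℝ[X]} {a b : ℕ → ℝ} (hq0 : q 0 = 1) (hq1 : q 1 = Polynomial.X - C (a 0))
    (hrec : ∀ n, q (n + 2) = (Polynomial.X - C (a (n + 1))) * q (n + 1) - C (b (n + 1)) * q n) (hr0 : r 0 = 0) (hr1 : r 1 = 1)
    (hrrec : ∀ n, r (n + 2) = (Polynomial.X - C (a (n + 1))) * r (n + 1) - C (b (n + 1)) * r n) (hb : ∀ j, 0 < b j) {m : ℕ} {z : Fin (m + 1) → ℝ}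
    (hz : StrictMono z) (hzr : ∀ k, (q (m + 1)).eval (z k) = 0) :
    r (m + 1) = ∑ k, C ((∏ l ∈ Finset.Ico 1 (m + 1), b l) / ((derivative (q (m + 1))).eval (z k) * (q m).eval (z k))) * ∏ j ∈ Finset.univ.erase k, (Polynomial.X - C (z j)) := by
  obtain ⟨hQm, hQd⟩ := recurrence_monic_natDegree hq0 hq1 hrec (m + 1)
  have hQ := eq_prod_X_sub_C_of_monic_of_roots hQm hQd hz.injective hzr
  obtain ⟨hRm, hRd⟩ := secondKind_monic_natDegree hr0 hr1 hrrec m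
  have hzs : Set.InjOn z (Finset.univ : Finset (Fin (m + 1))) := hz.injective.injOn.mono (Set.subset_univ _)
  refine eq_of_degrees_lt_of_eval_index_eq Finset.univ hzs ?_ ?_ fun i _ => ?_
  · rw [Finset.card_univ, Fintype.card_fin]
    exact lt_of_le_of_lt degree_le_natDegree (by rw [hRd]; exact_mod_cast Nat.lt_succ_self m)
  · rw [Finset.card_univ, Fintype.card_fin]
    have hnat : (∑ k, C ((∏ l ∈ Finset.Ico 1 (m + 1), b l) / ((derivative (q (m + 1))).eval (z k) * (q m).eval (z k))) * ∏ j ∈ Finset.univ.erase k, (Polynomial.X - C (z j))).natDegree ≤ m := by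
      refine natDegree_sum_le_of_forall_le _ _ fun k _ => (natDegree_C_mul_le _ _).trans ?_
      rw [natDegree_prod_of_monic _ _ fun j _ => monic_X_sub_C (z j)]
      simp only [natDegree_X_sub_C, Finset.sum_const, Finset.card_erase_of_mem (Finset.mem_univ k), Finset.card_univ, Fintype.card_fin, smul_eq_mul, mul_one]
      omega
    exact lt_of_le_of_lt degree_le_natDegree (by exact_mod_cast Nat.lt_succ_of_le hnat)
  · -- evaluation at `z_i`: only the `i`-th partial fraction survives
    rw [eval_finsetSum, Finset.sum_eq_single i (fun k _ hki => by
        rw [eval_mul, eval_C, eval_prod, Finset.prod_eq_zero (Finset.mem_erase.2 ⟨Ne.symm hki, Finset.mem_univ i⟩) (by rw [eval_sub, eval_X, eval_C, sub_self]), mul_zero])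
      (fun h => absurd (Finset.mem_univ i) h), eval_mul, eval_C, eval_prod]
    have hprod : ∏ j ∈ Finset.univ.erase i, (Polynomial.X - C (z j)).eval (z i) = (derivative (q (m + 1))).eval (z i) := by
      rw [hQ, eval_derivative_prod_X_sub_C_at_node]
      exact Finset.prod_congr rfl fun j _ => by rw [eval_sub, eval_X, eval_C]
    rw [hprod, favard_weight_eq_secondKind_div_derivative hq0 hrec hr0 hr1 hrrec hb m (hzr i)]
    have hne : (derivative (q (m + 1))).eval (z i) ≠ 0 := by
      rw [hQ, eval_derivative_prod_X_sub_C_at_node]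
      exact Finset.prod_ne_zero_iff.2 fun j hj => sub_ne_zero.2 fun e => (Finset.mem_erase.1 hj).1 (hz.injective e).symm
    field_simp

/-- **THE STIELTJES TRANSFORM OF THE GAUSS RULE IS `r_{m+1}/q_{m+1}`**: for `y` with `q_{m+1}(y) ≠ 0`, `Σ_k μ_k/(y − z_k) = r_{m+1}(y)/q_{m+1}(y)` (Favard weights `μ_k`, zeros `z_k`).
[Stieltjes 1894; Chihara III §4 (4.11)–(4.12); Akhiezer I §4; this file, §1049] -/
theorem sum_weight_div_sub_eq_secondKind_div {q r : ℕ → ℝ[X]} {a b : ℕ → ℝ} (hq0 : q 0 = 1) (hq1 : q 1 = Polynomial.X - C (a 0))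
    (hrec : ∀ n, q (n + 2) = (Polynomial.X - C (a (n + 1))) * q (n + 1) - C (b (n + 1)) * q n) (hr0 : r 0 = 0) (hr1 : r 1 = 1)
    (hrrec : ∀ n, r (n + 2) = (Polynomial.X - C (a (n + 1))) * r (n + 1) - C (b (n + 1)) * r n) (hb : ∀ j, 0 < b j) {m : ℕ} {z : Fin (m + 1) → ℝ}
    (hz : StrictMono z) (hzr : ∀ k, (q (m + 1)).eval (z k) = 0) {y : ℝ} (hy : (q (m + 1)).eval y ≠ 0) :
    ∑ k, (∏ l ∈ Finset.Ico 1 (m + 1), b l) / ((derivative (q (m + 1))).eval (z k) * (q m).eval (z k)) / (y - z k) = (r (m + 1)).eval y / (q (m + 1)).eval y := by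
  obtain ⟨hQm, hQd⟩ := recurrence_monic_natDegree hq0 hq1 hrec (m + 1)
  have hQ := eq_prod_X_sub_C_of_monic_of_roots hQm hQd hz.injective hzr
  rw [secondKind_eq_sum_weight_mul_prod hq0 hq1 hrec hr0 hr1 hrrec hb hz hzr, eval_finsetSum, Finset.sum_div]
  refine Finset.sum_congr rfl fun k _ => ?_
  have hsplit : (y - z k) * (∏ j ∈ Finset.univ.erase k, (Polynomial.X - C (z j))).eval y = (q (m + 1)).eval y := by
    have h := Finset.mul_prod_erase Finset.univ (fun j => (Polynomial.X - C (z j)).eval y) (Finset.mem_univ k)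
    rw [eval_sub, eval_X, eval_C] at h
    rw [hQ, eval_prod, eval_prod]
    exact h
  have hne : (y - z k) * (∏ j ∈ Finset.univ.erase k, (Polynomial.X - C (z j))).eval y ≠ 0 := by rw [hsplit]; exact hy
  obtain ⟨h1, h2⟩ := mul_ne_zero_iff.1 hne
  rw [eval_mul, eval_C, ← hsplit]
  field_simp

end Summit.Ventures.HSemireg.Wedge.HankelOuter
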